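import Mathlib.CategoryTheory.Limits.Shapes.Pullback.Iso
import Mathlib.CategoryTheory.Limits.Preserves.Shapes.Pullbacks
import Mathlib.CategoryTheory.Limits.Preserves.Shapes.Equalizers
import Mathlib.CategoryTheory.Limits.Preserves.Shapes.Terminal
import Literature.AnabelianGeometry.SemiGraphs.QuasiTemperoidsCharts
import Literature.AnabelianGeometry.SemiGraphs.QuasiTemperoidsPiProofs
import Literature.AnabelianGeometry.SemiGraphs.QuasiTemperoidsRemarksProofs
import Literature.AnabelianGeometry.SemiGraphs.TemperoidsCountablyConnectedTransport
import Literature.AnabelianGeometry.SemiGraphs.TemperoidsProductLayer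
import Literature.AnabelianGeometry.SemiGraphs.TemperoidsGaloisObjectsProofs
import Literature.AnabelianGeometry.SemiGraphs.BTempStructureProofs
import Literature.AnabelianGeometry.SemiGraphs.BTempLimitsProofs

/-!
# Semi-graphs of anabelioids, Appendix: proof of Proposition A.2 (iv) (faithfulness of morphisms of connected quasi-temperoids)

Mochizuki, *Semi-graphs of anabelioids*, Publ. RIMS **42** (2006), Appendix, Proposition A.2 (iv)
p. 80 (author's manuscript; PRIMS p. 310): "If `φ` is a morphism of quasi-temperoids, and both `E` and
`E′` are of cardinality one, then the functor `φ^*` is faithful." PROOF-ONLY companion (theorems, no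
definitions) to abc-iut-L3-t2's `QuasiTemperoids.lean` (named fact `PropA2iv`), by the wave-4 seat
abc-iut-w4-d076 on abc-iut-L3-lead's sub-node (3).

The print argues via products `A × C`, `B × C` splitting as coproducts of copies of a connected `C` and
the induced maps on `π₀`. The kernel proof below is a different (shorter) route through the SAME two
inputs the print names — `φ^*` is exact enough (finite limits) and "nondegenerate, hence, in
particular, nonempty" objects stay nonempty under `φ^*`:

* in a connected quasi-temperoid `Q ≃ T[A] ⊆ B^temp(Π)` equalizers and pullbacks exist and a
  monomorphism `e : E ↪ X` that is not an isomorphism MISSES A CONNECTED SUB-OBJECT: there is a connected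
  `C → X` (the orbit `Π·x ≅ Π/Stab(x)` of a point `x ∉ e(E)`) such that every `P` mapping compatibly to
  `C` and to `E` over `X` is empty [initial] (`IsConnectedQuasiTemperoid.exists_connected_disjoint`);
* given `φ^* f = φ^* g`, the equalizer `e` of `f, g` is carried by `φ^*` to the equalizer of equal
  arrows, an isomorphism; if `e` were not an isomorphism, the pullback `P = C ×_X E` would be initial,
  `φ^* P` initial (countable colimits) and `φ^* P ≅ φ^* C` (pullback of the isomorphism `φ^* e`), while
  `C` connected ⇒ nonempty ⇒ nondegenerate ⇒ `φ^* C` nondegenerate ⇒ nonempty — contradiction; so `e`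
  is an isomorphism and `f = g` (`PropA2iv_holds`).

[cite: MochizukiSemiAnbd2006, Prop A.2(iv) p.80]; typed ≠ endorsed; no statement of the paper is changed.
-/

open CategoryTheory CategoryTheory.Limits Topology

namespace Literature.AnabelianGeometry.SemiGraphs

open Literature.AlgebraicGeometry.Frobenioids (IsConnectedObj IsNonemptyObj)
open Literature.AlgebraicGeometry.Frobenioids.QuasiTemperoid (IsConnectedQuasiTemperoid)

universe v₁ v₂ u u₁ u₂

/-! ### The chart `T[A] ⊆ B^temp(Π)`: equalizers, pullbacks, monomorphisms, missed orbits -/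

section Chart

variable {G : Type u} [Group G] [TopologicalSpace G]

/-- Equivariance of a morphism of `Π`-sets under `T[A] ⊆ B^temp(Π)`, pointwise. [folklore] -/
private theorem overPrime_hom_ρ {A : BTemp G} {X Y : Over' A} (f : X ⟶ Y) (g : G) (x : X.obj.obj.V) :
    (f.hom.hom.hom (X.obj.obj.ρ g x) : Y.obj.obj.V) = Y.obj.obj.ρ g (f.hom.hom.hom x) := by
  have e := ConcreteCategory.congr_hom (f.hom.hom.comm g) x
  simp only [types_comp_apply] at e
  exact e

/-- `C[A]` is closed under limits of any shape with an object `j₀` (the limit maps to `A` through the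
`j₀`-th leg of its cone). [cite: MochizukiSemiAnbd2006, §0 p.6] -/
theorem admitsHomTo_isClosedUnderLimitsOfShape {C : Type u₁} [Category.{v₁} C] (A : C)
    (J : Type) [SmallCategory J] (j₀ : J) : (admitsHomTo A).IsClosedUnderLimitsOfShape J :=
  ⟨fun _ hX => by
    obtain ⟨p⟩ := hX
    exact ⟨p.π.app j₀ ≫ (p.prop_diag_obj j₀).some⟩⟩

variable [IsTopologicalGroup G]

/-- `T[A] ⊆ B^temp(Π)` has limits of every finite shape with an object (computed in `B^temp(Π)`): in
particular equalizers and pullbacks. [cite: MochizukiSemiAnbd2006, Def A.1(i) p.79] -/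
theorem overPrime_hasLimitsOfShape (A : BTemp G) (J : Type) [SmallCategory J] [FinCategory J]
    (j₀ : J) : HasLimitsOfShape J (Over' A) := by
  haveI := BTemp.hasLimitsOfShape_of_finCategory (G := G) J
  haveI := admitsHomTo_isClosedUnderLimitsOfShape A J j₀
  exact hasLimitsOfShape_of_closedUnderLimits J (admitsHomTo A)

omit [IsTopologicalGroup G] in
/-- A monomorphism of `T[A]` is a monomorphism of `B^temp(Π)` (test objects of `B^temp(Π)` mapping to
the source acquire a structure map to `A`), hence INJECTIVE on points (`BTemp.mono_iff_injective`).
[cite: MochizukiSemiAnbd2006, Def A.1(i) p.79] -/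
theorem overPrime_injective_of_mono {A : BTemp G} {X Y : Over' A} (f : X ⟶ Y) [Mono f] :
    Function.Injective fun x : X.obj.obj.V => (f.hom.hom.hom x : Y.obj.obj.V) := by
  haveI : Mono f.hom := by
    refine ⟨fun {Z} g h e => ?_⟩
    let Z' : Over' A := ⟨Z, ⟨g ≫ X.property.some⟩⟩
    have := (cancel_mono f).mp (show (ObjectProperty.homMk g : Z' ⟶ X) ≫ f = ObjectProperty.homMk h ≫ f
      from ObjectProperty.hom_ext _ e)
    exact congrArg (fun k : Z' ⟶ X => k.hom) this
  exact (BTemp.mono_iff_injective f.hom).mp inferInstance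

omit [IsTopologicalGroup G] in
/-- A morphism of `T[A]` that is bijective on points is an isomorphism (isomorphisms of `Π`-sets are the
equivariant bijections; `T[A] ⊆ B^temp(Π) ⊆ (Π-sets)` are full subcategories).
[cite: MochizukiSemiAnbd2006, Def A.1(i) p.79] -/
theorem overPrime_isIso_of_bijective {A : BTemp G} {X Y : Over' A} (f : X ⟶ Y)
    (hf : Function.Bijective fun x : X.obj.obj.V => (f.hom.hom.hom x : Y.obj.obj.V)) : IsIso f := by
  haveI h3 : IsIso f.hom.hom.hom := (isIso_iff_bijective _).mpr hf
  haveI h2 : IsIso f.hom.hom := Action.isIso_of_hom_isIso _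
  haveI : IsIso ((temperedAction G).ι.map f.hom) := by rw [ObjectProperty.ι_map]; exact h2
  haveI h1 : IsIso f.hom := isIso_of_fully_faithful (temperedAction G).ι f.hom
  haveI : IsIso ((admitsHomTo A).ι.map f) := by rw [ObjectProperty.ι_map]; exact h1
  exact isIso_of_fully_faithful (admitsHomTo A).ι f

/-- **The orbit missed by a proper monomorphism.** In `T[A] ⊆ B^temp(Π)` (`Π` tempered), if a
monomorphism `e : E ↪ X` is not an isomorphism then some point `x ∉ e(E)`; its orbit `Π/Stab(x) → X` is a
CONNECTED object `C` over `X`, and — `e(E)` being `Π`-stable — no nonempty `P` maps compatibly to `C` and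
to `E` over `X`. [cite: MochizukiSemiAnbd2006, Prop A.2(iv) p.80] -/
theorem overPrime_exists_connected_disjoint (hG : IsTempered G) {A : BTemp G} {E X : Over' A}
    (e : E ⟶ X) [Mono e] (he : ¬ IsIso e) :
    ∃ (C : Over' A) (c : C ⟶ X), IsConnectedObj C ∧
      ∀ (P : Over' A) (p₁ : P ⟶ C) (p₂ : P ⟶ E), p₁ ≫ c = p₂ ≫ e → ¬ IsNonemptyObj P := by
  have hinj := overPrime_injective_of_mono e
  -- a point outside the image
  obtain ⟨x₀, hx₀⟩ : ∃ x₀ : X.obj.obj.V, ∀ y : E.obj.obj.V, (e.hom.hom.hom y : X.obj.obj.V) ≠ x₀ := by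
    by_contra h
    push Not at h
    exact he (overPrime_isIso_of_bijective e ⟨hinj, fun x => h x⟩)
  letI : MulAction G X.obj.obj.V := Action.instMulAction X.obj.obj
  -- the orbit of `x₀` as the coset object `Π/Stab(x₀)` over `X`
  let H : Subgroup G := MulAction.stabilizer G x₀
  have hH : IsOpen (H : Set G) := X.obj.property.2 x₀
  obtain ⟨fC, hfC⟩ := GaloisObjects.exists_hom_quotientObj hG H hH (X := X.obj) x₀
    (fun k hk => MulAction.mem_stabilizer_iff.mp hk)
  obtain ⟨pX⟩ := X.property
  refine ⟨⟨BTemp.quotientObj G hG H hH, ⟨fC ≫ pX⟩⟩, ObjectProperty.homMk fC,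
    overPrime_isConnectedObj_of_isConnectedObj _ (GaloisObjects.isConnectedObj_quotientObj hG H hH),
    fun P p₁ p₂ hsq hP => ?_⟩
  obtain ⟨p⟩ := overPrime_nonempty_of_isNonemptyObj hP
  -- `p₁ p = g · 1` for some `g`, so `c (p₁ p) = g · x₀`
  obtain ⟨g, hg⟩ := GaloisObjects.quotientObj_transitive hG H hH (p₁.hom.hom.hom p)
  have h1 : (fC.hom.hom (p₁.hom.hom.hom p) : X.obj.obj.V) = X.obj.obj.ρ g x₀ := by
    rw [← hg, ← hfC]
    exact overPrime_hom_ρ (ObjectProperty.homMk fC :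
      (⟨BTemp.quotientObj G hG H hH, ⟨fC ≫ pX⟩⟩ : Over' A) ⟶ X) g _
  -- the square gives `e (p₂ p) = g · x₀`, so `x₀ = e (g⁻¹ · p₂ p)`: contradiction
  have h2 : (e.hom.hom.hom (p₂.hom.hom.hom p) : X.obj.obj.V) = X.obj.obj.ρ g x₀ := by
    have := congrArg (fun k : P ⟶ X => (k.hom.hom.hom p : X.obj.obj.V)) hsq
    simp only at this
    rw [← h1]
    exact this.symm
  apply hx₀ (E.obj.obj.ρ g⁻¹ (p₂.hom.hom.hom p))
  rw [overPrime_hom_ρ, h2]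
  change (X.obj.obj.ρ g⁻¹ * X.obj.obj.ρ g) x₀ = x₀
  rw [← map_mul, inv_mul_cancel, map_one]
  rfl

end Chart

/-! ### Connected quasi-temperoids: the same, transported along a chart `Q ≌ T[A]` -/

section ConnectedQuasiTemperoid

variable {Q : Type u₁} [Category.{v₁} Q]

/-- A connected quasi-temperoid has limits of every finite shape with an object — equalizers,
pullbacks, binary products (NOT the empty limit: no terminal object in general, Rmk A.1.2).
[cite: MochizukiSemiAnbd2006, Def A.1(i) p.79] -/
theorem _root_.Literature.AlgebraicGeometry.Frobenioids.QuasiTemperoid.IsConnectedQuasiTemperoid.hasLimitsOfShape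
    (hQ : IsConnectedQuasiTemperoid.{v₁, u₁, u} Q) (J : Type) [SmallCategory J] [FinCategory J]
    (j₀ : J) : HasLimitsOfShape J Q := by
  obtain ⟨c⟩ := isConnectedQuasiTemperoid_iff_nonempty_chart.mp hQ
  haveI := overPrime_hasLimitsOfShape c.A J j₀
  exact Adjunction.hasLimitsOfShape_of_equivalence c.equiv.functor

/-- Transport of "a proper monomorphism misses a connected sub-object" along an equivalence of
categories `e : Q ≌ D`: pull the missed connected `C′ → e X` back to `e⁻¹ C′ → X` (the lift of
`e e⁻¹ C′ ≅ C′ → e X` along the full functor `e`); compatible pairs into it map to compatible pairs into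
`C′`. [cite: MochizukiSemiAnbd2006, Prop A.2(iv) p.80] -/
theorem exists_connected_disjoint_of_equivalence {D : Type u₂} [Category.{v₂} D] (e : Q ≌ D)
    (hD : ∀ {E X : D} (m : E ⟶ X) [Mono m], ¬ IsIso m → ∃ (C : D) (c : C ⟶ X), IsConnectedObj C ∧
      ∀ (P : D) (p₁ : P ⟶ C) (p₂ : P ⟶ E), p₁ ≫ c = p₂ ≫ m → ¬ IsNonemptyObj P)
    {E X : Q} (m : E ⟶ X) [Mono m] (hm : ¬ IsIso m) :
    ∃ (C : Q) (c : C ⟶ X), IsConnectedObj C ∧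
      ∀ (P : Q) (p₁ : P ⟶ C) (p₂ : P ⟶ E), p₁ ≫ c = p₂ ≫ m → ¬ IsNonemptyObj P := by
  have hm' : ¬ IsIso (e.functor.map m) := fun h => hm (isIso_of_fully_faithful e.functor m)
  obtain ⟨C', c', hC', hdis⟩ := hD (e.functor.map m) hm'
  -- `C := e⁻¹ C′` with `c : e⁻¹ C′ → X` the (unique) lift of `e e⁻¹ C′ ≅ C′ → e X` along the full functor `e`
  refine ⟨e.inverse.obj C', e.functor.preimage (e.counit.app C' ≫ c'),
    TemperoidTransport.isConnectedObj_functor_obj e.symm hC', fun P p₁ p₂ hsq hP => ?_⟩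
  refine hdis (e.functor.obj P) (e.functor.map p₁ ≫ e.counit.app C') (e.functor.map p₂) ?_
    (TemperoidTransport.isNonemptyObj_functor_obj e hP)
  have h2 := congrArg (fun k => e.functor.map k) hsq
  simp only [Functor.map_comp, Functor.map_preimage] at h2
  rw [Category.assoc]
  exact h2

/-- **The connected sub-object missed by a proper monomorphism**, in any connected quasi-temperoid:
if a monomorphism `m : E ↪ X` is not an isomorphism, there is a connected `C → X` such that no nonempty
[non-initial] `P` maps compatibly to `C` and to `E` over `X` (`overPrime_exists_connected_disjoint`
transported along a chart `Q ≌ T[A]`). [cite: MochizukiSemiAnbd2006, Prop A.2(iv) p.80] -/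
theorem _root_.Literature.AlgebraicGeometry.Frobenioids.QuasiTemperoid.IsConnectedQuasiTemperoid.exists_connected_disjoint
    (hQ : IsConnectedQuasiTemperoid.{v₁, u₁, u} Q) {E X : Q} (m : E ⟶ X) [Mono m] (hm : ¬ IsIso m) :
    ∃ (C : Q) (c : C ⟶ X), IsConnectedObj C ∧
      ∀ (P : Q) (p₁ : P ⟶ C) (p₂ : P ⟶ E), p₁ ≫ c = p₂ ≫ m → ¬ IsNonemptyObj P := by
  obtain ⟨ch⟩ := isConnectedQuasiTemperoid_iff_nonempty_chart.mp hQ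
  exact exists_connected_disjoint_of_equivalence ch.equiv
    (fun m' _ hm' => overPrime_exists_connected_disjoint ch.isTempered m' hm') m hm

/-- In a connected quasi-temperoid an arrow out of a non-initial object has non-initial target.
[cite: MochizukiSemiAnbd2006, Def A.1(i) p.79] -/
private theorem isNonemptyObj_of_hom' (hQ : IsConnectedQuasiTemperoid.{v₁, u₁, u} Q) {A B : Q}
    (f : A ⟶ B) (hA : IsNonemptyObj A) : IsNonemptyObj B := by
  by_contra hB
  obtain ⟨hBI⟩ := TemperoidProduct.nonempty_isInitial_of_not_isNonemptyObj hB
  obtain ⟨hAI⟩ := hQ.nonempty_isInitial_of_hom hBI f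
  exact hA.false hAI

/-- In a connected quasi-temperoid a NONDEGENERATE object is nonempty [non-initial]: it is dominated,
together with any connected object (one exists), by a connected — hence nonempty — object.
[cite: MochizukiSemiAnbd2006, Def A.1(ii) p.79] -/
theorem _root_.Literature.AlgebraicGeometry.Frobenioids.QuasiTemperoid.IsConnectedQuasiTemperoid.isNonemptyObj_of_isNondegenerateObj
    (hQ : IsConnectedQuasiTemperoid.{v₁, u₁, u} Q) {N : Q} (hN : IsNondegenerateObj N) :
    IsNonemptyObj N := by
  obtain ⟨B, hB, -⟩ := hQ.exists_isConnectedObj_isNondegenerateObj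
  obtain ⟨C, hC, -, ⟨k⟩⟩ := hN B hB
  exact isNonemptyObj_of_hom' hQ k hC.1

end ConnectedQuasiTemperoid

/-! ### Proposition A.2 (iv) -/

section Faithful

variable {Q₁ : Type u₁} [Category.{v₁} Q₁] {Q₂ : Type u₂} [Category.{v₂} Q₂]

/-- **Faithfulness engine.** A functor `F : Q₂ ⥤ Q₁` between connected quasi-temperoids that preserves
equalizers, pullbacks and initial objects and carries connected objects of `Q₂` to nonempty
[non-initial] objects of `Q₁` is faithful: for `F f = F g` the equalizer `e` of `f, g` maps to an
isomorphism; were `e` not an isomorphism, the connected `C → X` missed by `e`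
(`exists_connected_disjoint`) would have initial pullback `C ×_X E`, whose image `F C ×_{F X} F E ≅ F C`
(pullback of the isomorphism `F e`) would be both initial and nonempty.
[cite: MochizukiSemiAnbd2006, Prop A.2(iv) p.80] -/
theorem faithful_of_preserves_of_isNonemptyObj_map
    (hQ₁ : IsConnectedQuasiTemperoid.{v₁, u₁, u} Q₁) (hQ₂ : IsConnectedQuasiTemperoid.{v₂, u₂, u} Q₂)
    (F : Q₂ ⥤ Q₁) [PreservesLimitsOfShape WalkingParallelPair F] [PreservesLimitsOfShape WalkingCospan F]
    [PreservesColimitsOfShape (Discrete PEmpty.{1}) F]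
    (hF : ∀ C : Q₂, IsConnectedObj C → IsNonemptyObj (F.obj C)) : F.Faithful := by
  haveI : HasLimitsOfShape WalkingParallelPair Q₂ := hQ₂.hasLimitsOfShape _ WalkingParallelPair.zero
  haveI : HasLimitsOfShape WalkingCospan Q₂ := hQ₂.hasLimitsOfShape _ WalkingCospan.one
  haveI : HasLimitsOfShape WalkingCospan Q₁ := hQ₁.hasLimitsOfShape _ WalkingCospan.one
  refine ⟨fun {X Y} f g hfg => ?_⟩
  -- the equalizer of `f, g` and its image, the equalizer of `F f = F g`: an isomorphism
  let e := equalizer.ι f g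
  haveI hFe : IsIso (F.map e) := by
    have hl := isLimitForkMapOfIsLimit F (equalizer.condition f g) (equalizerIsEqualizer f g)
    exact isIso_limit_cone_parallelPair_of_eq hfg hl
  -- `e` is an isomorphism: otherwise a connected sub-object of `X` is missed by `e`
  haveI : IsIso e := by
    by_contra he
    obtain ⟨C, c, hC, hdis⟩ := hQ₂.exists_connected_disjoint e he
    -- the pullback `C ×_X E` is initial
    have hP : ¬ IsNonemptyObj (pullback c e) :=
      hdis _ (pullback.fst c e) (pullback.snd c e) pullback.condition
    obtain ⟨hPI⟩ := TemperoidProduct.nonempty_isInitial_of_not_isNonemptyObj hP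
    -- its image is initial and isomorphic to `F C`
    have hFPI : IsInitial (F.obj (pullback c e)) := hPI.isInitialObj F
    haveI : IsIso (F.map (pullback.fst c e)) := by
      rw [← PreservesPullback.iso_hom_fst F c e]
      infer_instance
    have hFCI : IsInitial (F.obj C) := hFPI.ofIso (asIso (F.map (pullback.fst c e)))
    exact (hF C hC).false hFCI
  -- hence `f = g`
  rw [← cancel_epi e]
  exact equalizer.condition f g

/-- **Proposition A.2 (iv), DISCHARGED** (SemiAnbd Appendix p. 80; PRIMS p. 310): "If `φ` is a morphism
of quasi-temperoids, and both `E` and `E′` are of cardinality one, then the functor `φ^*` is faithful" —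
for connected quasi-temperoids `Q₁`, `Q₂` and a morphism `φ : Q₁ → Q₂` (a quasi-morphism whose functor
`φ^* : Q₂ ⥤ Q₁` preserves finite limits, countable colimits and nondegenerate objects), `φ^*` is faithful.
Connected objects of `Q₂` are nonempty hence nondegenerate (`exists_isConnectedObj_hom_hom`), so `φ^*`
carries them to nondegenerate, hence nonempty, objects of `Q₁`; then `faithful_of_preserves_of_isNonemptyObj_map`.
[cite: MochizukiSemiAnbd2006, Prop A.2(iv) p.80] -/
theorem PropA2iv_holds : PropA2iv.{u, u₁, u₂, v₁, v₂} := by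
  intro Q₁ _ Q₂ _ hQ₁ hQ₂ φ hφ
  haveI := φ.preservesFiniteLimits
  haveI : PreservesColimitsOfShape (Discrete PEmpty.{1}) φ.pullback :=
    φ.preservesCountableColimits (Discrete PEmpty.{1})
  refine faithful_of_preserves_of_isNonemptyObj_map hQ₁ hQ₂ φ.pullback fun C hC => ?_
  refine hQ₁.isNonemptyObj_of_isNondegenerateObj (hφ C fun B hB => ?_)
  exact hQ₂.exists_isConnectedObj_hom_hom hB.1 hC.1

end Faithful

end Literature.AnabelianGeometry.SemiGraphs
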